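import Summits.AtomisticToContinuum.HydrodynamicLimit.Theses.CollisionIsometryCLT
import Literature.MathematicalPhysics.KineticTheory.HardSphereEulerProofs

/-!
# `FastMomentRelaxation` (stmt-AtomisticToContinuum-9522), negative knowledge 2a: block kinetic-stress algebra

Support file for the standing disprover of the crux `CollisionIsometryCLT.FastMomentRelaxation`
(`Cruxes/FastMomentRelaxation/Disproof.lean`, refuter-cdisprove-stmt-AtomisticToContinuum-9522-0).
It is the DETERMINISTIC half of the load-bearing analysis of the hypothesis `0 < σ` (collisions): the
crux's observable — the traceless block kinetic stress `D` and the central heat flux `q` of the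
`φ_N`-blocks — is rewritten as elementary algebra of the weights `wᵢ = φ(xᵢ - x)` and the velocities
`vᵢ` (`crux_integrand_eq`), and the following facts, valid for EVERY configuration, are proved:

* `rawC_eq`, `rawD_zero_zero_ge`: `C̄ₗ = P̄ₗ - ρ̄ūₗ²` and `D₀₀ ≥ ⅔P̄₀ - ⅓(P̄₁ + P̄₂) - ⅔ρ̄ū₀²`
  (the deviator sees the second moments minus the bulk-flow energy);
* `integral_rawP`, `integral_rawD00_ge`: `∫ₓ P̄ₗ dx = Tₗ ∫φ` (Haar invariance on `𝕋³`), hence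
  `∫ₓ D₀₀ dx ≥ A - ⅔∫ₓ ρ̄ū₀² dx` with the GLOBAL anisotropy `A = ⅔T₀ - ⅓(T₁ + T₂)`, `Tₗ = n⁻¹∑ᵢvᵢₗ²`;
* uniform bounds (`rawObs_le`), measurability (`measurable_rawObs`) and integrability in the block centre;
* `core_lower_bound`: along the FREE FLIGHT of any configuration (velocities, hence `A`, conserved), if
  `t·A - ⅔∫₀ᵗ∫ₓ ρ̄ū₀² > m/2 > 0` then `∫₀ᵗ∫ₓ (∑D² + |q|²) > m²/(8t)` (Jensen twice).

The probabilistic half (`Negative/WithoutSigmaPos.lean`, in preparation) evaluates `A` and `∫ρ̄ū₀²` under the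
local Gibbs law of a SHEAR profile transported by the free gas (`σ = 0` is an admitted value once `0 < σ` is
dropped; `freeFlow₀` inhabits the flow type): Gaussian dephasing kills the bulk shear energy while `A = ⅓`
persists, so the crux's conclusion fails at `σ = 0` — the free gas "has no mechanism to thermalize its
velocity distribution" (Spohn 1991 §3.3, (3.36)): any proof of the crux must use the collisions.
All statements are kinetic-theory bookkeeping, tagged `[folklore]`.
-/

noncomputable section

open MeasureTheory Filter Set Topology Function
open scoped ENNReal Topology BigOperators

namespace Summit.AtomisticToContinuum.HydrodynamicLimit.Theorems

namespace FastMomentRelaxationNegative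

open Literature.MathematicalPhysics.KineticTheory Literature.Analysis.FluidPDE

/-! ## Raw block quantities: weights `w : Fin n → ℝ` and velocities `v : Fin n → V3` -/

section Raw

variable {n : ℕ} (w : Fin n → ℝ) (v : Fin n → V3)

/-- Raw block density `n⁻¹ ∑ wᵢ`. [folklore] -/
def rawRho : ℝ := (n : ℝ)⁻¹ * ∑ i, w i

/-- Raw block momentum coordinate `n⁻¹ ∑ wᵢ vᵢₗ`. [folklore] -/
def rawMom (l : Fin 3) : ℝ := (n : ℝ)⁻¹ * ∑ i, w i * v i l

/-- Raw block velocity coordinate `ρ̄⁻¹ m̄ₗ` (junk `0` on an empty block). [folklore] -/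
def rawU (l : Fin 3) : ℝ := (rawRho w)⁻¹ * rawMom w v l

/-- Raw second velocity moment `n⁻¹ ∑ wᵢ vᵢₗ²`. [folklore] -/
def rawP (l : Fin 3) : ℝ := (n : ℝ)⁻¹ * ∑ i, w i * v i l ^ 2

/-- Raw central second moment `n⁻¹ ∑ wᵢ (vᵢₗ - ūₗ)²`. [folklore] -/
def rawC (l : Fin 3) : ℝ := (n : ℝ)⁻¹ * ∑ i, w i * (v i l - rawU w v l) ^ 2

/-- Raw central stress `n⁻¹ ∑ wᵢ (vᵢⱼ - ūⱼ)(vᵢₖ - ūₖ)`. [folklore] -/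
def rawS (j k : Fin 3) : ℝ := (n : ℝ)⁻¹ * ∑ i, w i * ((v i j - rawU w v j) * (v i k - rawU w v k))

/-- Raw traceless central stress `D`. [folklore] -/
def rawD (j k : Fin 3) : ℝ := rawS w v j k - (if j = k then (∑ l, rawC w v l) / 3 else 0)

/-- The bulk-flow energy density of the block in direction `l`: `ρ̄⁻¹ m̄ₗ² = ρ̄ ūₗ²`. [folklore] -/
def rawBulk (l : Fin 3) : ℝ := (rawRho w)⁻¹ * rawMom w v l ^ 2

/-- The central second moment is the diagonal of the central stress. [folklore] -/
theorem rawC_eq_rawS (l : Fin 3) : rawC w v l = rawS w v l l := by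
  simp only [rawC, rawS, sq]

/-- `C̄ₗ = P̄ₗ - ρ̄⁻¹ m̄ₗ²` (exact, including the empty block `ρ̄ = 0`). [folklore] -/
theorem rawC_eq (l : Fin 3) : rawC w v l = rawP w v l - rawBulk w v l := by
  have hexp : rawC w v l = rawP w v l - 2 * rawU w v l * rawMom w v l + rawU w v l ^ 2 * rawRho w := by
    simp only [rawC, rawP, rawMom, rawRho]
    have : ∀ i, w i * (v i l - rawU w v l) ^ 2 =
        w i * v i l ^ 2 - 2 * rawU w v l * (w i * v i l) + rawU w v l ^ 2 * w i := fun i => by ring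
    simp_rw [this, Finset.sum_add_distrib, Finset.sum_sub_distrib, ← Finset.mul_sum]
    ring
  rw [hexp, rawBulk, rawU]
  set ρ := rawRho w
  set m := rawMom w v l
  have key : ρ⁻¹ * ρ⁻¹ * ρ = ρ⁻¹ := by
    rcases eq_or_ne ρ 0 with h | h
    · simp [h]
    · field_simp
  calc rawP w v l - 2 * (ρ⁻¹ * m) * m + (ρ⁻¹ * m) ^ 2 * ρ
      = rawP w v l - 2 * (ρ⁻¹ * m ^ 2) + (ρ⁻¹ * ρ⁻¹ * ρ) * m ^ 2 := by ring
    _ = rawP w v l - ρ⁻¹ * m ^ 2 := by rw [key]; ring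

/-- `D₀₀ = ⅔(P̄₀ - ρ̄ū₀²) - ⅓(P̄₁ - ρ̄ū₁²) - ⅓(P̄₂ - ρ̄ū₂²)`. [folklore] -/
theorem rawD_zero_zero_eq :
    rawD w v 0 0 = 2 / 3 * (rawP w v 0 - rawBulk w v 0) - 1 / 3 * (rawP w v 1 - rawBulk w v 1)
      - 1 / 3 * (rawP w v 2 - rawBulk w v 2) := by
  simp only [rawD, if_true, Fin.sum_univ_three, ← rawC_eq_rawS, rawC_eq]
  ring

variable {w}

/-- Block density is nonnegative for nonnegative weights. [folklore] -/
theorem rawRho_nonneg (hw : ∀ i, 0 ≤ w i) : 0 ≤ rawRho w :=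
  mul_nonneg (inv_nonneg.2 (Nat.cast_nonneg n)) (Finset.sum_nonneg fun i _ => hw i)

/-- Bulk-flow energy `ρ̄ūₗ² ≥ 0` for nonnegative weights. [folklore] -/
theorem rawBulk_nonneg (hw : ∀ i, 0 ≤ w i) (l : Fin 3) : 0 ≤ rawBulk w v l :=
  mul_nonneg (inv_nonneg.2 (rawRho_nonneg hw)) (sq_nonneg _)

/-- Second moments are nonnegative for nonnegative weights. [folklore] -/
theorem rawP_nonneg (hw : ∀ i, 0 ≤ w i) (l : Fin 3) : 0 ≤ rawP w v l :=
  mul_nonneg (inv_nonneg.2 (Nat.cast_nonneg n))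
    (Finset.sum_nonneg fun i _ => mul_nonneg (hw i) (sq_nonneg _))

/-- Central second moments are nonnegative for nonnegative weights. [folklore] -/
theorem rawC_nonneg (hw : ∀ i, 0 ≤ w i) (l : Fin 3) : 0 ≤ rawC w v l :=
  mul_nonneg (inv_nonneg.2 (Nat.cast_nonneg n))
    (Finset.sum_nonneg fun i _ => mul_nonneg (hw i) (sq_nonneg _))

/-- Weighted Cauchy–Schwarz: `ρ̄ ūₗ² ≤ P̄ₗ`, i.e. `m̄ₗ² ≤ ρ̄ P̄ₗ`. [folklore] -/
theorem rawBulk_le_rawP (hw : ∀ i, 0 ≤ w i) (l : Fin 3) : rawBulk w v l ≤ rawP w v l := by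
  have h := rawC_nonneg v hw l
  rw [rawC_eq] at h
  linarith

/-- **The lower bound on `D₀₀`**: `D₀₀ ≥ ⅔P̄₀ - ⅓(P̄₁ + P̄₂) - ⅔ ρ̄ū₀²`. [folklore] -/
theorem rawD_zero_zero_ge (hw : ∀ i, 0 ≤ w i) :
    2 / 3 * rawP w v 0 - 1 / 3 * (rawP w v 1 + rawP w v 2) - 2 / 3 * rawBulk w v 0 ≤ rawD w v 0 0 := by
  rw [rawD_zero_zero_eq]
  have h1 := rawBulk_nonneg v hw 1
  have h2 := rawBulk_nonneg v hw 2
  linarith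

end Raw

/-! ## Vector forms, the heat flux, the observable -/

section RawVec

variable {n : ℕ} (w : Fin n → ℝ) (v : Fin n → V3)

/-- Raw block momentum `n⁻¹ ∑ wᵢ vᵢ`. [folklore] -/
def rawMomVec : V3 := (n : ℝ)⁻¹ • ∑ i, w i • v i

/-- Raw block velocity `ρ̄⁻¹ m̄` (junk `0` on an empty block). [folklore] -/
def rawUvec : V3 := (rawRho w)⁻¹ • rawMomVec w v

/-- Raw block central kinetic heat flux `n⁻¹ ∑ (wᵢ |vᵢ - ū|²/2) (vᵢ - ū)`. [folklore] -/
def rawQ : V3 := (n : ℝ)⁻¹ • ∑ i, (w i * ‖v i - rawUvec w v‖ ^ 2 / 2) • (v i - rawUvec w v)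

/-- The observable `∑ⱼₖ Dⱼₖ² + |q|²`. [folklore] -/
def rawObs : ℝ := (∑ j, ∑ k, rawD w v j k ^ 2) + ‖rawQ w v‖ ^ 2

/-- Coordinates of the raw momentum vector. [folklore] -/
theorem rawMomVec_apply (l : Fin 3) : rawMomVec w v l = rawMom w v l := by
  simp only [rawMomVec, rawMom, PiLp.smul_apply, WithLp.ofLp_sum, Finset.sum_apply, smul_eq_mul]

/-- Coordinates of the raw block velocity. [folklore] -/
theorem rawUvec_apply (l : Fin 3) : rawUvec w v l = rawU w v l := by
  simp only [rawUvec, rawU, PiLp.smul_apply, smul_eq_mul, rawMomVec_apply]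

/-- One squared deviator entry is at most the observable. [folklore] -/
theorem rawD_sq_le_rawObs (j k : Fin 3) : rawD w v j k ^ 2 ≤ rawObs w v := by
  have h1 : rawD w v j k ^ 2 ≤ ∑ k', rawD w v j k' ^ 2 :=
    Finset.single_le_sum (f := fun k' => rawD w v j k' ^ 2) (fun _ _ => sq_nonneg _) (Finset.mem_univ k)
  have h2 : ∑ k', rawD w v j k' ^ 2 ≤ ∑ j', ∑ k', rawD w v j' k' ^ 2 :=
    Finset.single_le_sum (f := fun j' => ∑ k', rawD w v j' k' ^ 2)
      (fun _ _ => Finset.sum_nonneg fun _ _ => sq_nonneg _) (Finset.mem_univ j)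
  have h3 : 0 ≤ ‖rawQ w v‖ ^ 2 := sq_nonneg _
  unfold rawObs
  linarith

/-- The observable is nonnegative. [folklore] -/
theorem rawObs_nonneg : 0 ≤ rawObs w v :=
  add_nonneg (Finset.sum_nonneg fun _ _ => Finset.sum_nonneg fun _ _ => sq_nonneg _) (sq_nonneg _)

/-- The global second velocity moments `Tₗ = n⁻¹ ∑ᵢ vᵢₗ²` (conserved by free flight). [folklore] -/
def rawT (l : Fin 3) : ℝ := (n : ℝ)⁻¹ * ∑ i, v i l ^ 2

/-- The global anisotropy functional `A = ⅔T₀ - ⅓(T₁ + T₂)`. [folklore] -/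
def rawA : ℝ := 2 / 3 * rawT v 0 - 1 / 3 * (rawT v 1 + rawT v 2)

end RawVec

/-! ## Bridge: the crux's block fields are the raw quantities of `wᵢ = φ(xᵢ - x)`, `vᵢ` -/

section Bridge

variable {n : ℕ} (φ : T3 → ℝ) (z : Config n (Fin 3) T3) (x : T3)

/-- The kernel weights `wᵢ = φ(xᵢ - x)` of a configuration seen from the block centre `x`. [folklore] -/
def wt : Fin n → ℝ := fun i => φ ((z i).1 - x)

/-- The velocities of a configuration. [folklore] -/
def vel : Fin n → V3 := fun i => (z i).2

/-- The crux's block density is `rawRho` of the kernel weights. [folklore] -/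
theorem rho_eq : empiricalDensityField z (fun y => φ (y - x)) = rawRho (wt φ z x) := by
  rw [empiricalDensityField_eq_sum]; rfl

/-- The crux's block momentum is `rawMomVec` of the kernel weights. [folklore] -/
theorem mom_eq : empiricalMomentumField z (fun y => φ (y - x)) = rawMomVec (wt φ z x) (vel z) := by
  rw [empiricalMomentumField_eq_sum]; rfl

/-- The crux's block velocity is `rawUvec` of the kernel weights. [folklore] -/
theorem ub_eq : (empiricalDensityField z (fun y => φ (y - x)))⁻¹ • empiricalMomentumField z (fun y => φ (y - x))
    = rawUvec (wt φ z x) (vel z) := by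
  rw [rho_eq, mom_eq]; rfl

/-- Bochner integration of a vector field against the empirical measure: `∫ F dμ_z = N⁻¹ ∑ F(zᵢ)`.
[folklore] -/
theorem integral_empiricalMeasure_vec {N : ℕ} (z : Config N (Fin 3) T3) (F : T3 × V3 → V3) :
    ∫ y, F y ∂empiricalMeasure z = (N : ℝ)⁻¹ • ∑ i, F (z i) := by
  simp only [empiricalMeasure_eq, integral_smul_measure]
  rw [integral_finsetSum_measure fun i _ => integrable_dirac enorm_lt_top]
  simp [integral_dirac, ENNReal.toReal_inv]

/-- **Bridge.** The crux's integrand `∑ⱼₖ D² + |q|²` at configuration `z` and block centre `x` is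
`rawObs` of the weights `φ(xᵢ - x)` and the velocities. [folklore] -/
theorem crux_integrand_eq :
    ((∑ j, ∑ k,
        ((∫ y, φ (y.1 - x) * ((y.2 j - ((empiricalDensityField z (fun y => φ (y - x)))⁻¹ •
            empiricalMomentumField z (fun y => φ (y - x))) j) *
            (y.2 k - ((empiricalDensityField z (fun y => φ (y - x)))⁻¹ •
              empiricalMomentumField z (fun y => φ (y - x))) k)) ∂(empiricalMeasure z)) -
          (if j = k then
            (∑ l : Fin 3, ∫ y, φ (y.1 - x) * (y.2 l - ((empiricalDensityField z (fun y => φ (y - x)))⁻¹ •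
              empiricalMomentumField z (fun y => φ (y - x))) l) ^ 2 ∂(empiricalMeasure z)) / 3
          else 0)) ^ 2) +
      ‖∫ y, (φ (y.1 - x) * ‖y.2 - (empiricalDensityField z (fun y => φ (y - x)))⁻¹ •
            empiricalMomentumField z (fun y => φ (y - x))‖ ^ 2 / 2) •
          (y.2 - (empiricalDensityField z (fun y => φ (y - x)))⁻¹ •
            empiricalMomentumField z (fun y => φ (y - x))) ∂(empiricalMeasure z)‖ ^ 2)
    = rawObs (wt φ z x) (vel z) := by
  simp only [ub_eq, integral_empiricalMeasure, integral_empiricalMeasure_vec, rawObs, rawD, rawS, rawC, rawQ,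
    rawUvec_apply]
  rfl

end Bridge

end FastMomentRelaxationNegative

end Summit.AtomisticToContinuum.HydrodynamicLimit.Theorems

end
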